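import Literature.Geometry.Riemannian.KernelNashEntropyLipschitz
import Literature.Geometry.Riemannian.KernelNashEntropyJensen
import Literature.Geometry.Riemannian.KernelNashEntropySuperharmonic
import Literature.Geometry.Riemannian.MetricFlowWassersteinMonotone
import Literature.Geometry.Riemannian.MetricFlowVarianceBounds
import Literature.Geometry.Riemannian.RicciFlowHConcentrationHolds
import Literature.Geometry.Riemannian.MetricFlowHCenters
import Literature.Geometry.Riemannian.RicciFlowMetricFlow
import Literature.Geometry.Riemannian.RiemannianMetricSpace
import HarnessLib

/-!
# The oscillation of the pointed Nash entropy is controlled by the `W₁`-distance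
# (Bamler 2020a, Cor. 5.11 / arXiv v1 Cor. 20)

R. Bamler, *Entropy and heat kernel bounds on a Ricci flow background*, arXiv:2008.07093 (2020a),
§5.1, Corollary after Thm. 5.9 (journal Cor. 5.11, arXiv v1 Cor. 20): *"if `R ≥ R_min` on
`M × [s, t*]`, `s < t* ≤ min{t₁, t₂}` and `(x₁,t₁), (x₂,t₂) ∈ M × I`, then
`𝒩*_s(x₁,t₁) − 𝒩*_s(x₂,t₂) ≤ (n/(2(t*−s)) − R_min)^{1/2} d_{W₁}^{g_{t*}}(ν_{x₁,t₁}(t*),`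
`ν_{x₂,t₂}(t*)) + (n/2) log((t₂ − s)/(t* − s))`."*

The printed proof: *"by Proposition 5.… [(5.15)] `𝒩*_s(x₁,t₁) ≤ ∫ 𝒩*_s(·,t*) dν_{x₁,t₁;t*}`,
`𝒩*_s(x₂,t₂) ≥ ∫ 𝒩*_s(·,t*) dν_{x₂,t₂;t*} − (n/2) log((t₂−s)/(t*−s))`, and `𝒩*_s(·,t*)` is
`(n/(2(t*−s)) − R_min)^{1/2}`-Lipschitz by Theorem 5.9"* — which is exactly how it is assembled
here, for the conjugate heat kernel measures `ν_{x,t;s} = heatKernelMeasure` of a Ricci flow on a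
closed connected manifold modelled on `ℝᵐ` (`m ≥ 3`):

* the first half of (5.15) is `kernelNashEntropy_le_integral_kernelNashEntropy_heatKernelMeasure`
  (`KernelNashEntropySuperharmonic.lean`), the second (Jensen) half is
  `integral_kernelNashEntropy_heatKernelMeasure_le` (`KernelNashEntropyJensen.lean`);
* the Lipschitz bound is `IsRicciFlow.ofReal_abs_kernelNashEntropy_sub_le`
  (`KernelNashEntropyLipschitz.lean`);
* the pairing of a Lipschitz function against two probability measures is bounded by the
  `W₁`-distance of the slice `(M, d_{g_{t*}})` (`ofReal_integral_sub_integral_le_wassersteinW1`,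
  the easy half of Kantorovich duality), for the metric space `g_{t*}.metricSpace`.

Main statement: `IsRicciFlow.ofReal_kernelNashEntropy_sub_sub_le_mul_wassersteinW1`. The strict
inequality `t₁ < T` (rather than `≤`) is inherited from the base-point regularity of the tree's heat
kernel on the closed parameter interval; it is harmless in applications (extend the flow).
Everything is proved; no definitions, no named facts.

## References

* R. H. Bamler, *Entropy and heat kernel bounds on a Ricci flow background*, arXiv:2008.07093
  (2020), §5.1, Thm. 5.9, Cor. 5.11 (arXiv v1: Thm. 19, Cor. 20). [Bamler2020Entropy]
* R. H. Bamler, *Compactness theory of the space of super Ricci flows*, Invent. Math. 233 (2023),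
  §2.1 (the `W₁`-Wasserstein distance). [Bamler2023]
-/

noncomputable section

open Set Filter Function MeasureTheory Measure
open scoped Manifold ContDiff Topology ENNReal NNReal

namespace Literature.Geometry.Riemannian

open Lorentzian Lorentzian.PseudoRiemannianMetric

section Pairing

variable {X : Type*} [MetricSpace X] [MeasurableSpace X] [BorelSpace X]
  [SecondCountableTopology X]

/-- **A `K`-Lipschitz bounded function pairs against two probability measures with difference at
most `K · d_{W₁}`**: `∫ u dμ − ∫ u dν ≤ K d_{W₁}(μ, ν)` (in `[0, ∞]`), the scaled form of the easy
half of Kantorovich duality `ofReal_integral_sub_integral_le_wassersteinW1`.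
[cite: Bamler2023, §2.1 (Wasserstein distance, duality display)] -/
theorem ofReal_integral_sub_integral_le_mul_wassersteinW1 (μ ν : Measure X)
    [IsProbabilityMeasure μ] [IsProbabilityMeasure ν] {u : X → ℝ} (hum : Measurable u) {C : ℝ}
    (hC : ∀ x, |u x| ≤ C) {K : ℝ≥0} (hu : LipschitzWith K u) :
    ENNReal.ofReal (∫ x, u x ∂μ - ∫ x, u x ∂ν) ≤ K * wassersteinW1 μ ν := by
  rcases eq_or_ne K 0 with hK | hK
  · -- `u` is constant
    subst hK
    have hconst : ∀ x y, u x = u y := fun x y ↦ by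
      have := hu x y
      simp only [ENNReal.coe_zero, zero_mul, nonpos_iff_eq_zero, edist_eq_zero] at this
      exact this
    rcases isEmpty_or_nonempty X with hX | ⟨⟨x₀⟩⟩
    · have h1 : (μ : Measure X) univ = 1 := measure_univ
      rw [Set.univ_eq_empty_iff.mpr hX, measure_empty] at h1
      exact absurd h1 zero_ne_one
    · have h1 : ∫ x, u x ∂μ = u x₀ := by
        rw [show (fun x ↦ u x) = fun _ ↦ u x₀ from funext fun x ↦ hconst x x₀]
        simp
      have h2 : ∫ x, u x ∂ν = u x₀ := by
        rw [show (fun x ↦ u x) = fun _ ↦ u x₀ from funext fun x ↦ hconst x x₀]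
        simp
      simp [h1, h2]
  · have hKpos : (0 : ℝ) < K := by positivity
    -- apply the unscaled inequality to `u / K`
    have hu' : LipschitzWith 1 fun x ↦ (K : ℝ)⁻¹ * u x := by
      refine LipschitzWith.of_dist_le_mul fun x y ↦ ?_
      have hxy := hu.dist_le_mul x y
      rw [Real.dist_eq] at hxy ⊢
      rw [← mul_sub, abs_mul, abs_of_pos (inv_pos.mpr hKpos), NNReal.coe_one, one_mul]
      calc (K : ℝ)⁻¹ * |u x - u y| ≤ (K : ℝ)⁻¹ * (K * dist x y) :=
            mul_le_mul_of_nonneg_left hxy (inv_pos.mpr hKpos).le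
        _ = dist x y := by rw [← mul_assoc, inv_mul_cancel₀ hKpos.ne', one_mul]
    have hC' : ∀ x, |(K : ℝ)⁻¹ * u x| ≤ (K : ℝ)⁻¹ * C := fun x ↦ by
      rw [abs_mul, abs_of_pos (inv_pos.mpr hKpos)]
      exact mul_le_mul_of_nonneg_left (hC x) (inv_pos.mpr hKpos).le
    have hmain := ofReal_integral_sub_integral_le_wassersteinW1 μ ν (hum.const_mul _) hC' hu'
    rw [integral_const_mul, integral_const_mul, ← mul_sub] at hmain
    -- multiply through by `K`
    have hK' : (K : ℝ≥0∞) = ENNReal.ofReal (K : ℝ) := by simp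
    calc ENNReal.ofReal (∫ x, u x ∂μ - ∫ x, u x ∂ν)
        = ENNReal.ofReal ((K : ℝ) * ((K : ℝ)⁻¹ * (∫ x, u x ∂μ - ∫ x, u x ∂ν))) := by
          rw [← mul_assoc, mul_inv_cancel₀ hKpos.ne', one_mul]
      _ = K * ENNReal.ofReal ((K : ℝ)⁻¹ * (∫ x, u x ∂μ - ∫ x, u x ∂ν)) := by
          rw [ENNReal.ofReal_mul hKpos.le, hK']
      _ ≤ K * wassersteinW1 μ ν := by gcongr
end Pairing

section Oscillation

variable {m : ℕ} {M : Type*} [TopologicalSpace M] [ChartedSpace (EuclideanSpace ℝ (Fin m)) M]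
  [IsManifold 𝓘(ℝ, EuclideanSpace ℝ (Fin m)) ∞ M] [T2Space M] [CompactSpace M]
  [SecondCountableTopology M] [MeasurableSpace M] [BorelSpace M] [ConnectedSpace M]
  {h : ℝ → PseudoRiemannianMetric 𝓘(ℝ, EuclideanSpace ℝ (Fin m)) ∞ (EuclideanSpace ℝ (Fin m))
    (TangentSpace 𝓘(ℝ, EuclideanSpace ℝ (Fin m)) : M → Type _)}
  {cov : ℝ → CovariantDerivative 𝓘(ℝ, EuclideanSpace ℝ (Fin m)) (EuclideanSpace ℝ (Fin m))
    (TangentSpace 𝓘(ℝ, EuclideanSpace ℝ (Fin m)) : M → Type _)}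
  {a T : ℝ} (hflow : IsRicciFlow h cov (Icc a T)) (hh : IsContMDiffFamilyOn ∞ h univ)
  (hR : ∀ r, (h r).IsRiemannian)

/-- **Bamler 2020a, Cor. 5.11 (arXiv v1 Cor. 20): the `W₁`-oscillation bound for the pointed Nash
entropy.** Let `hflow = (h, cov)` be a Ricci flow on `[a, T]` of a `C^∞` family of Riemannian
metrics on a closed connected manifold modelled on `ℝᵐ` (`m ≥ 3`), let
`a < s < t* ≤ min(t₁, t₂)` with `t₁ < T`, `t₂ ≤ T`, and `R_{g_s} ≥ R_min`. Writing
`𝒩*_s(x,t) = 𝒩_{x,t}(t − s)` for the pointed Nash entropy of the conjugate heat kernel based at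
`(x,t)` and `ν_{x,t;t*} = heatKernelMeasure … t x t*`, we have

  `𝒩*_s(x₁,t₁) − 𝒩*_s(x₂,t₂) − (m/2) log((t₂ − s)/(t* − s))`
  `  ≤ (m/(2(t* − s)) − R_min)^{1/2} · d_{W₁}^{g_{t*}}(ν_{x₁,t₁;t*}, ν_{x₂,t₂;t*})`

(in `[0, ∞]`, the left side through `ENNReal.ofReal`, the `W₁`-distance taken in the metric space
`(M, d_{g_{t*}})`). [cite: Bamler2020Entropy, §5.1, Cor. 5.11 (arXiv v1 Cor. 20)] -/
theorem IsRicciFlow.ofReal_kernelNashEntropy_sub_sub_le_mul_wassersteinW1 (hm : 3 ≤ m)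
    {s tstar t₁ t₂ : ℝ} (has : a < s) (hst : s < tstar) (h₁ : tstar ≤ t₁) (h₂ : tstar ≤ t₂)
    (ht₁ : t₁ < T) (ht₂ : t₂ ≤ T) {Rmin : ℝ}
    (hRmin : ∀ y, Rmin ≤ (h s).scalarCurvatureWith (cov s) y) (x₁ x₂ : M) :
    ENNReal.ofReal
        (pointedNashEntropy h (fun r y ↦ hflow.heatKernelFn hh hR t₁ x₁ (y, r)) m t₁ s -
          pointedNashEntropy h (fun r y ↦ hflow.heatKernelFn hh hR t₂ x₂ (y, r)) m t₂ s -
          (m : ℝ) / 2 * Real.log ((t₂ - s) / (tstar - s))) ≤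
      ENNReal.ofReal (Real.sqrt ((m : ℝ) / (2 * (tstar - s)) - Rmin)) *
        (letI := (h tstar).metricSpace (hR tstar)
         wassersteinW1 (heatKernelMeasure hh hR t₁ x₁ tstar)
           (heatKernelMeasure hh hR t₂ x₂ tstar)) := by
  classical
  have htT : tstar < T := lt_of_le_of_lt h₁ ht₁
  -- notation: `N z = 𝒩*_s(z, t*)`, the two measures, the Lipschitz constant
  set N : M → ℝ :=
    fun z ↦ pointedNashEntropy h (fun r y ↦ hflow.heatKernelFn hh hR tstar z (y, r)) m tstar s
    with hN
  set ν₁ : Measure M := heatKernelMeasure hh hR t₁ x₁ tstar with hν₁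
  set ν₂ : Measure M := heatKernelMeasure hh hR t₂ x₂ tstar with hν₂
  set L : ℝ := Real.sqrt ((m : ℝ) / (2 * (tstar - s)) - Rmin) with hL
  have hL0 : 0 ≤ L := Real.sqrt_nonneg _
  -- (5.15), first half, at `(x₁, t₁)`: `𝒩*_s(x₁,t₁) ≤ ∫ N dν₁`
  have hfirst : pointedNashEntropy h (fun r y ↦ hflow.heatKernelFn hh hR t₁ x₁ (y, r)) m t₁ s ≤
      ∫ z, N z ∂ν₁ := by
    rcases eq_or_lt_of_le h₁ with heq | hlt
    · subst heq
      rw [hν₁, heatKernelMeasure_self, integral_dirac]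
    · exact kernelNashEntropy_le_integral_kernelNashEntropy_heatKernelMeasure hflow hh hR has hst
        hlt ht₁ x₁
  -- (5.15), second half (Jensen), at `(x₂, t₂)`: `∫ N dν₂ ≤ 𝒩*_s(x₂,t₂) + (m/2) log(…)`
  have hsecond : ∫ z, N z ∂ν₂ ≤
      pointedNashEntropy h (fun r y ↦ hflow.heatKernelFn hh hR t₂ x₂ (y, r)) m t₂ s +
        (m : ℝ) / 2 * Real.log ((t₂ - s) / (tstar - s)) := by
    rcases eq_or_lt_of_le h₂ with heq | hlt
    · subst heq
      rw [hν₂, heatKernelMeasure_self, integral_dirac, div_self (sub_pos.mpr hst).ne',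
        Real.log_one, mul_zero, add_zero]
    · exact integral_kernelNashEntropy_heatKernelMeasure_le hflow hh hR has hst hlt ht₂ x₂
  -- `N` is `L`-Lipschitz for `d_{g_{t*}}` (Thm. 5.9)
  letI : MetricSpace M := (h tstar).metricSpace (hR tstar)
  set L' : ℝ≥0 := ⟨L, hL0⟩ with hL'
  have hLcoe : (L' : ℝ≥0∞) = ENNReal.ofReal L := (ENNReal.ofReal_eq_coe_nnreal hL0).symm
  have hLip : LipschitzWith L' N := by
    rw [metricSpace_lipschitzWith_iff (hR tstar)]
    intro z z'
    rw [hLcoe]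
    exact hflow.ofReal_abs_kernelNashEntropy_sub_le hh hR hm has hst htT hRmin z z'
  have hcont : Continuous N := hLip.continuous
  have hmeas : Measurable N := hcont.measurable
  -- `N` is bounded (continuous on a compact space)
  obtain ⟨C, hC⟩ : ∃ C, ∀ z, |N z| ≤ C := by
    obtain ⟨C, hC⟩ := (isCompact_univ.image hcont).isBounded.subset_closedBall_lt 0 0
    exact ⟨C, fun z ↦ by
      have := hC.2 (Set.mem_image_of_mem N (Set.mem_univ z))
      simpa [Real.norm_eq_abs] using this⟩
  -- pairing against the two probability measures
  have hpair := ofReal_integral_sub_integral_le_mul_wassersteinW1 ν₁ ν₂ hmeas hC hLip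
  -- assemble
  have hreal : pointedNashEntropy h (fun r y ↦ hflow.heatKernelFn hh hR t₁ x₁ (y, r)) m t₁ s -
      pointedNashEntropy h (fun r y ↦ hflow.heatKernelFn hh hR t₂ x₂ (y, r)) m t₂ s -
      (m : ℝ) / 2 * Real.log ((t₂ - s) / (tstar - s)) ≤ ∫ z, N z ∂ν₁ - ∫ z, N z ∂ν₂ := by
    linarith
  rw [← hLcoe]
  exact (ENNReal.ofReal_le_ofReal hreal).trans hpair

/-- **Entropy comparison near an `H`-centre** (Bamler 2020a, §7.2, displays (7.7) and (7.9) in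
the proof of Thm. 7.1: "by Theorem 5.9 and Corollary 5.11 we have for any `y'`,
`−𝒩*_s(y', t₁) ≤ −𝒩*_s(z, t₁) + C d_{t₁}(z, y') ≤ −𝒩*_s(x, t) + C + C d_{t₁}(z, y')`"). For
`a < s < t₁ ≤ t < T`, `R_{g_s} ≥ R_min`, and a point `z₁` with
`∫ d_{t₁}²(z₁, ·) dν_{x,t;t₁} ≤ V` (e.g. an `H_m`-centre of `(x,t)`, `V = H_m(t − t₁)`), for all
`w`,

  `𝒩*_s(x,t) − 𝒩*_s(w,t₁) ≤ L (√V + d_{t₁}(z₁, w))`, `L = (m/(2(t₁−s)) − R_min)^{1/2}`: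

Cor. 5.11 at `t* = t₁` against `ν_{z₁,t₁;t₁} = δ_{z₁}` with
`d_{W₁}(ν_{x,t;t₁}, δ_{z₁}) ≤ √Var(δ_{z₁}, ν_{x,t;t₁}) ≤ √V`, plus the Lipschitz bound Thm. 5.9
at time `t₁`. [cite: Bamler2020Entropy, §7.2, proof of Thm. 7.1, (7.7) and (7.9)] -/
theorem kernelNashEntropy_sub_le_of_lintegral_edist_sq_le (hm : 3 ≤ m) {s t₁ t : ℝ} (has : a < s)
    (hst₁ : s < t₁) (ht₁t : t₁ ≤ t) (htT : t < T) {Rmin : ℝ}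
    (hRmin : ∀ z : M, Rmin ≤ (h s).scalarCurvatureWith (cov s) z) (x z₁ : M) {V : ℝ} (hV : 0 ≤ V)
    (hvar : ∫⁻ w, (h t₁).edist (hR t₁) z₁ w ^ 2 ∂(heatKernelMeasure hh hR t x t₁) ≤
      ENNReal.ofReal V) (w : M) :
    pointedNashEntropy h (fun r y ↦ hflow.heatKernelFn hh hR t x (y, r)) m t s -
        pointedNashEntropy h (fun r y ↦ hflow.heatKernelFn hh hR t₁ w (y, r)) m t₁ s ≤
      Real.sqrt ((m : ℝ) / (2 * (t₁ - s)) - Rmin) *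
        (Real.sqrt V + ((h t₁).edist (hR t₁) z₁ w).toReal) := by
  classical
  have ht₁T : t₁ < T := lt_of_le_of_lt ht₁t htT
  set L : ℝ := Real.sqrt ((m : ℝ) / (2 * (t₁ - s)) - Rmin) with hL
  have hL0 : 0 ≤ L := Real.sqrt_nonneg _
  set N : ℝ → M → ℝ := fun r z ↦
    pointedNashEntropy h (fun r' y ↦ hflow.heatKernelFn hh hR r z (y, r')) m r s with hN
  -- Cor. 5.11 at `t* = t₁`, `(x₁,t₁) := (x,t)`, `(x₂,t₂) := (z₁,t₁)`
  have hcor := hflow.ofReal_kernelNashEntropy_sub_sub_le_mul_wassersteinW1 hh hR hm has hst₁ ht₁t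
    le_rfl htT ht₁T.le hRmin x z₁
  rw [div_self (sub_pos.2 hst₁).ne', Real.log_one, mul_zero, sub_zero, heatKernelMeasure_self]
    at hcor
  -- `d_{W₁}(ν, δ_{z₁}) ≤ √Var(ν, δ_{z₁}) ≤ √V`
  letI : MetricSpace M := (h t₁).metricSpace (hR t₁)
  set ν : Measure M := heatKernelMeasure hh hR t x t₁ with hν
  have hW : wassersteinW1 ν (Measure.dirac z₁) ≤ ENNReal.ofReal (Real.sqrt V) := by
    refine (wassersteinW1_le_sqrt_variance ν (Measure.dirac z₁)).trans ?_
    rw [variance_comm, variance_dirac_left, Real.sqrt_eq_rpow, ← ENNReal.ofReal_rpow_of_nonneg hV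
      (by norm_num)]
    exact ENNReal.rpow_le_rpow hvar (by norm_num)
  -- hence `N t x − N t₁ z₁ ≤ L √V`
  have h1 : N t x - N t₁ z₁ ≤ L * Real.sqrt V := by
    have hc := hcor.trans (mul_le_mul' le_rfl hW)
    rw [← ENNReal.ofReal_mul hL0] at hc
    exact (ENNReal.ofReal_le_ofReal_iff (by positivity)).1 hc
  -- Lipschitz bound at time `t₁` (Thm. 5.9): `N t₁ z₁ − N t₁ w ≤ L d_{t₁}(z₁, w)`
  have h2 : N t₁ z₁ - N t₁ w ≤ L * ((h t₁).edist (hR t₁) z₁ w).toReal := by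
    have hl := hflow.ofReal_abs_kernelNashEntropy_sub_le hh hR hm has hst₁ ht₁T hRmin z₁ w
    have hne : (h t₁).edist (hR t₁) z₁ w ≠ ⊤ := PseudoRiemannianMetric.edist_ne_top (hR t₁) z₁ w
    rw [← ENNReal.ofReal_toReal hne, ← ENNReal.ofReal_mul hL0,
      ENNReal.ofReal_le_ofReal_iff (by positivity)] at hl
    exact (le_abs_self _).trans hl
  calc N t x - N t₁ w = (N t x - N t₁ z₁) + (N t₁ z₁ - N t₁ w) := by ring
    _ ≤ L * Real.sqrt V + L * ((h t₁).edist (hR t₁) z₁ w).toReal := add_le_add h1 h2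
    _ = L * (Real.sqrt V + ((h t₁).edist (hR t₁) z₁ w).toReal) := by ring

/-- `√r · √τ ≤ √K` whenever `r ≤ K/τ`, `τ > 0` — the form in which the Lipschitz constants
`L = √(m/(2(t₁−s)) − R_min)` of Thm. 5.9 are made scale-free (`L√τ ≤ √(m + Λ)`). [folklore] -/
theorem sqrt_mul_sqrt_le_sqrt_of_le_div {r τ K : ℝ} (hτ : 0 < τ) (hr : r ≤ K / τ) :
    Real.sqrt r * Real.sqrt τ ≤ Real.sqrt K := by
  rw [← Real.sqrt_mul' r hτ.le]
  refine Real.sqrt_le_sqrt ?_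
  calc r * τ ≤ K / τ * τ := mul_le_mul_of_nonneg_right hr hτ.le
    _ = K := div_mul_cancel₀ K hτ.ne'

/-- **An `H_m`-centre of `(x, t)` at an earlier time `t₁`, in kernel form**: some `z₁` with
`∫ d_{t₁}²(z₁, ·) dν_{x,t;t₁} ≤ H_m (t − t₁)`, `H_m = (m−1)π²/2 + 4` (Bamler 2020a, Prop. 3.11 with
the `H_m`-concentration Cor. 3.7; here from the metric-flow statements
`ricciFlowMetricFlow_isHConcentrated` and `IsHConcentrated.exists_isHCenter`) — the point to
feed into `kernelNashEntropy_sub_le_of_lintegral_edist_sq_le`.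
[cite: Bamler2020Entropy, §3.1, Prop. 3.11 and Cor. 3.7] -/
theorem IsRicciFlow.exists_lintegral_edist_sq_heatKernelMeasure_le
    (hflow : IsRicciFlow h cov (Icc a T)) (hm : 0 < m) {t₁ t : ℝ}
    (ht₁ : t₁ ∈ Icc a T) (ht : t ∈ Icc a T) (h1t : t₁ ≤ t) (x : M) :
    ∃ z₁ : M, ∫⁻ w, (h t₁).edist (hR t₁) z₁ w ^ 2 ∂(heatKernelMeasure hh hR t x t₁) ≤
      ENNReal.ofReal ((((m : ℝ) - 1) * Real.pi ^ 2 / 2 + 4) * (t - t₁)) := by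
  have hH := ricciFlowMetricFlow_isHConcentrated (cov := cov) hm hh hR Set.ordConnected_Icc hflow
  obtain ⟨z₁, hz₁⟩ := hH.exists_isHCenter (s := ⟨t₁, ht₁⟩) (t := ⟨t, ht⟩) h1t x
  refine ⟨z₁, ?_⟩
  have hvar := hz₁.lintegral_edist_sq_le
  simp only [ricciFlowMetricFlow_condKernel, MetricFlow.concentrationConst] at hvar
  exact hvar

end Oscillation

end Literature.Geometry.Riemannian

end
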